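import Literature.AlgebraicGeometry.Limits.SeparatedSchematicExt          -- ★ `pullback_map_injective_of_flat`, `isSchemeTheoreticallyDominant_specMap_of_injective`
import Literature.AlgebraicGeometry.Motives.IntegralModelReductionMap      -- ★ `IntegralModel.genericIso'`, `genericFibre`
import Literature.AlgebraicGeometry.RelativeSpec.ActionOverBaseChange      -- ★ `RelativeSpec.ActionOver`
import HarnessLib

/-!
# Integral models: endomorphisms and group actions of a flat separated model are determined by their generic fibre
# (EGA IV₃ 11.10.5 ∕ 11.10.1; SGA 1 V §1)

Topic `Literature/AlgebraicGeometry/Motives`; namespace `Literature.AlgebraicGeometry.Motives.IntegralModel`.  THEOREMS ONLY (no definition,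
no named fact, no instance, no notation, no `sorry`).  Cell `hodgecm-mathlib`, P6 «MOD programme», P6a ED.-2 census 8396c07d §6 item 2
(«`∀ θ` in MH (not `∃`): sound because extensions of `τ` to a flat separated model are UNIQUE») made a theorem: the UP letter
`RecordModuliPointwiseCoreUpstairsCofinal` quantifies over EVERY action `θ` of `Γ × G` on the local model `𝓨` extending the generic action `τ`
through `𝓨.genericIso'` (binder `_hθ`); the heart MH must therefore prove its datum for an ARBITRARY such `θ`, and does so by replacing `θ` with
the one action it knows (the moduli-theoretic one, or the spread one of ★ `Limits/LocalizationActionSpreadLocalise`) — legitimate exactly because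
`_hθ` DETERMINES `θ`.  HC_CM is proved only modulo the printed citations until rung 0 closes; nothing here is about HC.

THE MATHEMATICS.  Let `T` be a domain with fraction field `K`, `𝓨 → Spec T` flat, `𝓝 → Spec T` separated.  The generic fibre functor
`(-) ×_T Spec K` is INJECTIVE on `T`-morphisms `𝓨 → 𝓝` ([EGAIV3] 11.10.5: `𝓨_K → 𝓨` is schematically dominant, being the flat base change of the
schematically dominant `Spec K → Spec T`; 11.10.1: two morphisms to a separated scheme agreeing on a schematically dense subscheme are equal) —
★ `Limits.pullback_map_injective_of_flat`.  Hence (§1) two endomorphisms of the total space of a flat separated integral model with the same generic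
fibre are equal, and (§2) two actions `θ, θ′ : ActionOver 𝓨.total.hom H` whose automorphisms have the same generic fibres — in particular two
actions which both extend a given action `τ` on the generic fibre `X` through the model's generic isomorphism — are EQUAL ([SGA1] V §1).  §3 is
the number-field reading in the `genericFibre ∕ genericIso'` currency of the UP letter (`T = 𝒪_{F,(w)}`, `K = F`).

MAIN STATEMENTS.  §1 `hom_eq_of_baseChange_map_eq`; §2 `ActionOver.ext_aut` (two actions with the same automorphisms are equal),
`actionOver_eq_of_baseChange_map_eq`, `actionOver_eq_of_genericIso` ; §3 **`actionOver_eq_of_genericIso'`** — UP's `_hθ` for `θ` and for `θ′`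
implies `θ = θ′`.  §4 (ED. 2, the one extra clause of desk F0P6a-plan's organ (o-a3-UNIQ) 14:56:15Z): the same injectivity for morphisms
between TWO models — source flat, target separated — `hom_eq_of_baseChange_map_eq₂`, and its `genericFibre ∕ genericIso'` reading
`hom_eq_of_genericFibre_map_comp_genericIso'_eq`.

## References
* [EGAIV3] A. Grothendieck, J. Dieudonné, *EGA* IV₃, Publ. Math. IHÉS 28 (1966), 11.10.1 and 11.10.5.
* [SGA1] A. Grothendieck, *SGA 1*, Exp. V §1 (schemes with a group of operators).
* [GortzWedhorn2020] U. Görtz, T. Wedhorn, *Algebraic Geometry I* (2nd ed., 2020), Prop. 9.19 and Rem. 9.20 (pp. 233–234).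
-/

set_option autoImplicit false

noncomputable section

set_option backward.isDefEq.respectTransparency false

open CategoryTheory CategoryTheory.Limits AlgebraicGeometry IsDedekindDomain
open scoped NumberField
open Literature.AlgebraicGeometry.RelativeSpec (ActionOver)
open Literature.NumberTheory.EllipticCurves (genericFibre)

namespace Literature.AlgebraicGeometry.Motives.IntegralModel

/-! ## §1 Endomorphisms of a flat separated model are determined by their generic fibre -/

section Domain

variable {T K : Type} [CommRing T] [IsDomain T] [Field K] [Algebra T K] [IsFractionRing T K] {X : SchemeOver K}

/-- **Two endomorphisms of the total space of a flat separated integral model with the same generic fibre are equal** (the generic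
fibre functor `baseChange T K = (-) ×_T Spec K` is injective on morphisms from a flat to a separated `T`-scheme: ★
`Limits.pullback_map_injective_of_flat` at the schematically dominant `Spec K → Spec T`). [cite: EGAIV3, 11.10.5 and 11.10.1]
[cite: GortzWedhorn2020, Prop. 9.19 and Rem. 9.20] -/
theorem hom_eq_of_baseChange_map_eq (𝓨 : IntegralModel T K X) [Flat 𝓨.total.hom] [IsSeparated 𝓨.total.hom]
    (a b : 𝓨.total ⟶ 𝓨.total) (h : (baseChange T K).map a = (baseChange T K).map b) : a = b := by
  haveI : IsSchemeTheoreticallyDominant (Spec.map (CommRingCat.ofHom (algebraMap T K))) :=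
    Limits.isSchemeTheoreticallyDominant_specMap_of_injective _ (IsFractionRing.injective T K)
  exact Limits.pullback_map_injective_of_flat (Spec.map (CommRingCat.ofHom (algebraMap T K))) h

/-! ## §2 Actions of a group on a flat separated model are determined by their generic fibre -/

variable {H : Type*} [Group H]

omit [IsDomain T] [IsFractionRing T K] in
/-- Two actions over the same structure morphism with the same automorphisms are equal (`ActionOver` is `aut` plus a proposition).
[cite: SGA1, Exp. V §1] -/
theorem _root_.Literature.AlgebraicGeometry.RelativeSpec.ActionOver.ext_aut {Y S : Scheme} {r : Y ⟶ S} {θ θ' : ActionOver r H}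
    (h : ∀ a : H, θ.aut a = θ'.aut a) : θ = θ' := by
  obtain ⟨f, hf⟩ := θ
  obtain ⟨f', hf'⟩ := θ'
  have hff' : f = f' := MonoidHom.ext h
  subst hff'
  rfl

/-- **Two actions of `H` on a flat separated model whose automorphisms have the same generic fibres are equal.**
[cite: EGAIV3, 11.10.5 and 11.10.1] [cite: SGA1, Exp. V §1] -/
theorem actionOver_eq_of_baseChange_map_eq (𝓨 : IntegralModel T K X) [Flat 𝓨.total.hom] [IsSeparated 𝓨.total.hom]
    (θ θ' : ActionOver 𝓨.total.hom H)
    (h : ∀ a : H, (baseChange T K).map (Over.isoMk (θ.aut a) (θ.aut_comp a)).hom =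
      (baseChange T K).map (Over.isoMk (θ'.aut a) (θ'.aut_comp a)).hom) : θ = θ' := by
  refine ActionOver.ext_aut fun a => Iso.ext ?_
  have e := hom_eq_of_baseChange_map_eq 𝓨 _ _ (h a)
  exact congrArg CommaMorphism.left e

/-- **Two actions of `H` on a flat separated model which both extend an action `τ` on the generic fibre `X` (through the model's generic
isomorphism) are equal** — the uniqueness that makes «for every `θ` extending `τ`» a harmless quantifier. [cite: EGAIV3, 11.10.5 and 11.10.1]
[cite: SGA1, Exp. V §1] -/
theorem actionOver_eq_of_genericIso (𝓨 : IntegralModel T K X) [Flat 𝓨.total.hom] [IsSeparated 𝓨.total.hom]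
    (τ : ActionOver X.hom H) (θ θ' : ActionOver 𝓨.total.hom H)
    (hθ : ∀ a : H, (baseChange T K).map (Over.isoMk (θ.aut a) (θ.aut_comp a)).hom ≫ 𝓨.genericIso.hom =
      𝓨.genericIso.hom ≫ (Over.isoMk (τ.aut a) (τ.aut_comp a)).hom)
    (hθ' : ∀ a : H, (baseChange T K).map (Over.isoMk (θ'.aut a) (θ'.aut_comp a)).hom ≫ 𝓨.genericIso.hom =
      𝓨.genericIso.hom ≫ (Over.isoMk (τ.aut a) (τ.aut_comp a)).hom) : θ = θ' := by
  refine actionOver_eq_of_baseChange_map_eq 𝓨 θ θ' fun a => ?_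
  rw [← cancel_mono 𝓨.genericIso.hom, hθ a, hθ' a]

end Domain

/-! ## §3 Number fields: UP's `_hθ` determines `θ` -/

section NumberField

variable {F : Type} [Field F] [NumberField F] {w : HeightOneSpectrum (𝓞 F)} {Y : SchemeOver F} {H : Type*} [Group H]

/-- **UP's binder `_hθ` determines `θ`**: for a flat separated model `𝓨` of `Y` over `𝒪_{F,(w)}` and an action `τ` of `H` on `Y` over
`Spec F`, two actions `θ, θ′` of `H` on `𝓨` over `Spec 𝒪_{F,(w)}` satisfying the `_hθ` clause of the letter `RecordModuliPointwiseCoreUpstairsCofinal`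
(`(genericFibre 𝒪_(w) F).map θ(a) ≫ 𝓨.genericIso' = 𝓨.genericIso' ≫ τ(a)` for all `a`) are EQUAL — so a heart that knows ONE such action
(the moduli-theoretic one) may answer for ALL of them. [cite: EGAIV3, 11.10.5 and 11.10.1] [cite: SGA1, Exp. V §1] -/
theorem actionOver_eq_of_genericIso' (𝓨 : IntegralModel (HeightOneSpectrum.valuationSubringAtPrime F w) F Y)
    [Flat 𝓨.total.hom] [IsSeparated 𝓨.total.hom] (τ : ActionOver Y.hom H) (θ θ' : ActionOver 𝓨.total.hom H)
    (hθ : ∀ a : H,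
      (genericFibre (HeightOneSpectrum.valuationSubringAtPrime F w) F).map (Over.isoMk (θ.aut a) (θ.aut_comp a)).hom
          ≫ 𝓨.genericIso'.hom
        = 𝓨.genericIso'.hom ≫ (Over.isoMk (τ.aut a) (τ.aut_comp a)).hom)
    (hθ' : ∀ a : H,
      (genericFibre (HeightOneSpectrum.valuationSubringAtPrime F w) F).map (Over.isoMk (θ'.aut a) (θ'.aut_comp a)).hom
          ≫ 𝓨.genericIso'.hom
        = 𝓨.genericIso'.hom ≫ (Over.isoMk (τ.aut a) (τ.aut_comp a)).hom) : θ = θ' :=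
  actionOver_eq_of_genericIso 𝓨 τ θ θ' hθ hθ'

/-- **Corollary: the automorphisms agree** — for every `a`, `θ(a) = θ′(a)` as automorphisms of the total space (the form a heart uses to
rewrite special-fibre points `θ(γ, 1)_s · p`). [cite: SGA1, Exp. V §1] -/
theorem aut_eq_of_genericIso' (𝓨 : IntegralModel (HeightOneSpectrum.valuationSubringAtPrime F w) F Y)
    [Flat 𝓨.total.hom] [IsSeparated 𝓨.total.hom] (τ : ActionOver Y.hom H) (θ θ' : ActionOver 𝓨.total.hom H)
    (hθ : ∀ a : H,
      (genericFibre (HeightOneSpectrum.valuationSubringAtPrime F w) F).map (Over.isoMk (θ.aut a) (θ.aut_comp a)).hom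
          ≫ 𝓨.genericIso'.hom
        = 𝓨.genericIso'.hom ≫ (Over.isoMk (τ.aut a) (τ.aut_comp a)).hom)
    (hθ' : ∀ a : H,
      (genericFibre (HeightOneSpectrum.valuationSubringAtPrime F w) F).map (Over.isoMk (θ'.aut a) (θ'.aut_comp a)).hom
          ≫ 𝓨.genericIso'.hom
        = 𝓨.genericIso'.hom ≫ (Over.isoMk (τ.aut a) (τ.aut_comp a)).hom) (a : H) : θ.aut a = θ'.aut a := by
  rw [actionOver_eq_of_genericIso' 𝓨 τ θ θ' hθ hθ']

end NumberField

/-! ## §4 ED. 2 — morphisms between two models: source flat, target separated -/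

section TwoModels

variable {T K : Type} [CommRing T] [IsDomain T] [Field K] [Algebra T K] [IsFractionRing T K] {X Z : SchemeOver K}

/-- **Two morphisms from the total space of a FLAT model to the total space of a SEPARATED model with the same generic fibre are
equal** (★ `Limits.pullback_map_injective_of_flat` at the schematically dominant `Spec K → Spec T`; the two-model form of
`hom_eq_of_baseChange_map_eq`). [cite: EGAIV3, 11.10.5 and 11.10.1] [cite: GortzWedhorn2020, Prop. 9.19 and Rem. 9.20] -/
theorem hom_eq_of_baseChange_map_eq₂ (𝓨 : IntegralModel T K X) (𝓩 : IntegralModel T K Z) [Flat 𝓨.total.hom]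
    [IsSeparated 𝓩.total.hom] (a b : 𝓨.total ⟶ 𝓩.total) (h : (baseChange T K).map a = (baseChange T K).map b) : a = b := by
  haveI : IsSchemeTheoreticallyDominant (Spec.map (CommRingCat.ofHom (algebraMap T K))) :=
    Limits.isSchemeTheoreticallyDominant_specMap_of_injective _ (IsFractionRing.injective T K)
  exact Limits.pullback_map_injective_of_flat (Spec.map (CommRingCat.ofHom (algebraMap T K))) h

end TwoModels

section TwoModelsNumberField

variable {F : Type} [Field F] [NumberField F] {w : HeightOneSpectrum (𝓞 F)} {Y Z : SchemeOver F}

/-- **Number-field reading**: two morphisms `a b : 𝓨.total ⟶ 𝓩.total` of models over `𝒪_{F,(w)}` (`𝓨` flat, `𝓩` separated) covering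
the SAME morphism of generic fibres through the models' `genericIso'` — `(genericFibre 𝒪_(w) F).map a ≫ 𝓩.genericIso'.hom =
(genericFibre 𝒪_(w) F).map b ≫ 𝓩.genericIso'.hom` (the `_hū`-shape of the HLiu418 letters) — are equal.
[cite: EGAIV3, 11.10.5 and 11.10.1] -/
theorem hom_eq_of_genericFibre_map_comp_genericIso'_eq
    (𝓨 : IntegralModel (HeightOneSpectrum.valuationSubringAtPrime F w) F Y)
    (𝓩 : IntegralModel (HeightOneSpectrum.valuationSubringAtPrime F w) F Z) [Flat 𝓨.total.hom] [IsSeparated 𝓩.total.hom]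
    (a b : 𝓨.total ⟶ 𝓩.total)
    (h : (genericFibre (HeightOneSpectrum.valuationSubringAtPrime F w) F).map a ≫ 𝓩.genericIso'.hom =
      (genericFibre (HeightOneSpectrum.valuationSubringAtPrime F w) F).map b ≫ 𝓩.genericIso'.hom) : a = b := by
  refine hom_eq_of_baseChange_map_eq₂ 𝓨 𝓩 a b ?_
  rw [← cancel_mono 𝓩.genericIso'.hom]
  exact h

end TwoModelsNumberField

end Literature.AlgebraicGeometry.Motives.IntegralModel

end
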